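import Mathlib
import Summits.NavierStokesRegularity.NavierStokesRegularity.Theorems.ThreadingFluxHorizonTowerL2ClosedFormLaw
import Summits.NavierStokesRegularity.NavierStokesRegularity.Theorems.ThreadingFluxHorizonTowerCubicCertDet
import Summits.NavierStokesRegularity.NavierStokesRegularity.Theorems.ThreadingFluxHorizonTowerHarmonicCubic
import HarnessLib

/-!
# Crux `PoloidalLiouville` (stmt-NavierStokesRegularity-1222, wall W1), crux idea «horizon-threading-tower» (ns-idea-15):
# THE IDENTIFICATION STEP (ii) at l = 3 — `‖x‖⁶ · 𝔏₂[U_{H_a}](x) = horizonNumerator a x` — and `HorizonZonalitySingleDegree`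
# at `l = 3`, unconditionally

Identification lemma (helper) joining HT1-CERT-CORE (A) (ns-wall-eng-7 g3: `CubicCert.*`, p666886 … p668823, p670909, p670358) to the
sketch's c₂-law objects `horizonL2` / `horizonProfile` of `Theorems/ThreadingFluxHorizonTowerDefs.lean`, BY NAME, via the closed-form
law `HorizonTower.horizonL2_horizonProfile_eq_det` (all degrees; `ThreadingFluxHorizonTowerL2ClosedFormLaw.lean`).  Seat ns-wall-eng-4 g2,
cell ns-wall-extremal, item «HT1 (ii) IDENTIFICATION»; `--supports stmt-NavierStokesRegularity-1222 --as helper`.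

* `CubicCert.contDiff_cubicHE3`, `CubicCert.laplacian_cubicHE3` — `H_a` is smooth and harmonic;
* `CubicCert.gradient_cubicHE3_apply` — the components of `∇H_a` are the data file's `dHx/dHy/dHz`;
* `CubicCert.dHx_line/dHy_line/dHz_line`, `CubicCert.gradNormSq_cubicHE3_eq`, `CubicCert.inner_gradient_gradNormSq_cubicHE3` — the
  gradient of `G_a = ‖∇H_a‖²` through the written-out Hessian rows of `H_a`;
* `CubicCert.horizonNumerator_eq_inner_cross` — `horizonNumerator a p = −40 ⟪∇H_a(p), ∇G_a(p) × p⟫` (eng-7's `horizonNumerator_eq_det`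
  read through the kernel gradients);
* ★ `CubicCert.horizonL2_horizonProfile_cubicHE3` — **`‖x‖⁶ · horizonL2 (horizonProfile 3 (cubicHE3 a) 0) 0 x = horizonNumerator a (x 0) (x 1) (x 2)`**
  for `x ≠ 0` (THE IDENTIFICATION, formerly ENGINE-certified only, DATUM B-ht1);
* `CubicCert.horizonNumerator_eq_zero_of_horizonL2` — the hypothesis `hident` of `horizonZonality_degree_three_of_identification` (p670358);
* ★ `HorizonTower.horizonZonality_degree_three` — the `l = 3` instance of `HorizonZonalitySingleDegree`, now UNCONDITIONAL: a smooth
  degree-3 homogeneous harmonic `H` with `𝔏₂[U_H] ≡ 0` off the origin has the zonal form `H(y) = ‖y‖³ g(⟪n,y⟫/‖y‖)`.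

HONEST LABEL: not `HorizonZonalitySingleDegree` (all `l`) nor any sketch Prop by itself; information-grade for W1/W2 (movement 0);
`PoloidalLiouville` (1222), `UnthreadedRigidity` (27585) and NS regularity remain OPEN and untouched.  No `native_decide`/`decide`.
[cite: MajdaBertozziCUP2002, §1.1 (vector identities)]
-/

-- the summit and its single problem share the name (D-0017 nested layout)
set_option linter.dupNamespace false

noncomputable section

open Set Function Filter Topology
open scoped Topology RealInnerProductSpace
open Literature.Analysis.FluidPDE

namespace Summit.NavierStokesRegularity.NavierStokesRegularity.Theorems.PoloidalLiouville.HorizonTower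

namespace CubicCert

/-! ### Smoothness and harmonicity of `H_a` -/

/-- `H_a` is smooth (a polynomial in the coordinates). -/
theorem contDiff_cubicHE3 (a : Fin 7 → ℝ) : ContDiff ℝ (⊤ : ℕ∞) (cubicHE3 a) := by
  have hc : ∀ i : Fin 3, ContDiff ℝ (⊤ : ℕ∞) fun p : E3 => p i := fun i => (contDiff_euclidean.mp contDiff_id) i
  have h0 := hc 0
  have h1 := hc 1
  have h2 := hc 2
  unfold cubicHE3 cubicH
  fun_prop

/-- `H_a` is harmonic: `ΔH_a = 0` (Laplacian from line restrictions, `HorizonTower.laplacian_eq_sum_iteratedDeriv_line`; the trace of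
the written-out Hessian vanishes). -/
theorem laplacian_cubicHE3 (a : Fin 7 → ℝ) (p : E3) : Laplacian.laplacian (cubicHE3 a) p = 0 := by
  have h2 : ContDiff ℝ 2 (cubicHE3 a) := (contDiff_cubicHE3 a).of_le (by norm_cast)
  rw [laplacian_eq_sum_iteratedDeriv_line h2]
  have hline : ∀ m : Fin 3, iteratedDeriv 2 (fun t : ℝ => cubicHE3 a (p + t • EuclideanSpace.single m (1 : ℝ))) 0
      = 2 * taylorQuad a (p 0) (p 1) (p 2) ((EuclideanSpace.single m (1 : ℝ) : E3) 0)
          ((EuclideanSpace.single m (1 : ℝ) : E3) 1) ((EuclideanSpace.single m (1 : ℝ) : E3) 2) := by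
    intro m
    have hfun : (fun t : ℝ => cubicHE3 a (p + t • EuclideanSpace.single m (1 : ℝ))) = fun t : ℝ =>
        cubicHE3 a p + t * ((EuclideanSpace.single m (1 : ℝ) : E3) 0 * dHx a (p 0) (p 1) (p 2)
          + (EuclideanSpace.single m (1 : ℝ) : E3) 1 * dHy a (p 0) (p 1) (p 2)
          + (EuclideanSpace.single m (1 : ℝ) : E3) 2 * dHz a (p 0) (p 1) (p 2))
        + t ^ 2 * taylorQuad a (p 0) (p 1) (p 2) ((EuclideanSpace.single m (1 : ℝ) : E3) 0)
          ((EuclideanSpace.single m (1 : ℝ) : E3) 1) ((EuclideanSpace.single m (1 : ℝ) : E3) 2)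
        + t ^ 3 * cubicHE3 a (EuclideanSpace.single m (1 : ℝ)) := funext fun t => cubicHE3_line a p _ t
    rw [hfun, iteratedDeriv_two_cubic]
  simp only [hline, Fin.sum_univ_three]
  unfold taylorQuad
  simp
  ring

/-! ### The gradient of `H_a` and of `G_a = ‖∇H_a‖²` in coordinates -/

/-- The components of `∇H_a(p)` are `dHx, dHy, dHz` at `p`. -/
theorem gradient_cubicHE3_apply (a : Fin 7 → ℝ) (p : E3) :
    gradient (cubicHE3 a) p 0 = dHx a (p 0) (p 1) (p 2) ∧ gradient (cubicHE3 a) p 1 = dHy a (p 0) (p 1) (p 2)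
      ∧ gradient (cubicHE3 a) p 2 = dHz a (p 0) (p 1) (p 2) := by
  have h : ∀ i : Fin 3, gradient (cubicHE3 a) p i = ⟪gradient (cubicHE3 a) p, EuclideanSpace.single i (1 : ℝ)⟫ := by
    intro i
    rw [EuclideanSpace.inner_single_right]
    simp
  refine ⟨?_, ?_, ?_⟩ <;> rw [h, inner_gradient_cubicHE3] <;> simp

/-- `G_a = ‖∇H_a‖²` as an explicit polynomial in the coordinates. -/
theorem gradNormSq_cubicHE3_eq (a : Fin 7 → ℝ) :
    (fun w : E3 => ‖gradient (cubicHE3 a) w‖ ^ 2)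
      = fun w : E3 => dHx a (w 0) (w 1) (w 2) ^ 2 + dHy a (w 0) (w 1) (w 2) ^ 2 + dHz a (w 0) (w 1) (w 2) ^ 2 := by
  funext w
  obtain ⟨h0, h1, h2⟩ := gradient_cubicHE3_apply a w
  rw [EuclideanSpace.norm_sq_eq, Fin.sum_univ_three, Real.norm_eq_abs, Real.norm_eq_abs, Real.norm_eq_abs,
    sq_abs, sq_abs, sq_abs, h0, h1, h2]

/-- Exact expansion of the quadratic form `dHx` along a line (first-order term = the `x`-row of the Hessian of `H_a`). -/
theorem dHx_line (a : Fin 7 → ℝ) (p v : E3) (t : ℝ) :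
    dHx a ((p + t • v) 0) ((p + t • v) 1) ((p + t • v) 2)
      = dHx a (p 0) (p 1) (p 2)
        + t * (v 0 * (-(6 * p 0 * a 1) + 6 * p 0 * a 5 - 2 * p 1 * a 2 + 6 * p 1 * a 6 - 6 * p 2 * a 0 + 2 * p 2 * a 3)
          + v 1 * (-(2 * p 0 * a 2) + 6 * p 0 * a 6 - 2 * p 1 * a 1 - 6 * p 1 * a 5 + p 2 * a 4)
          + v 2 * (-(6 * p 0 * a 0) + 2 * p 0 * a 3 + p 1 * a 4 + 8 * p 2 * a 1))
        + t ^ 2 * dHx a (v 0) (v 1) (v 2) := by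
  simp only [PiLp.add_apply, PiLp.smul_apply, smul_eq_mul]
  unfold dHx
  ring

/-- Exact expansion of the quadratic form `dHy` along a line (first-order term = the `y`-row of the Hessian of `H_a`). -/
theorem dHy_line (a : Fin 7 → ℝ) (p v : E3) (t : ℝ) :
    dHy a ((p + t • v) 0) ((p + t • v) 1) ((p + t • v) 2)
      = dHy a (p 0) (p 1) (p 2)
        + t * (v 0 * (-(2 * p 0 * a 2) + 6 * p 0 * a 6 - 2 * p 1 * a 1 - 6 * p 1 * a 5 + p 2 * a 4)
          + v 1 * (-(2 * p 0 * a 1) - 6 * p 0 * a 5 - 6 * p 1 * a 2 - 6 * p 1 * a 6 - 6 * p 2 * a 0 - 2 * p 2 * a 3)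
          + v 2 * (p 0 * a 4 - 6 * p 1 * a 0 - 2 * p 1 * a 3 + 8 * p 2 * a 2))
        + t ^ 2 * dHy a (v 0) (v 1) (v 2) := by
  simp only [PiLp.add_apply, PiLp.smul_apply, smul_eq_mul]
  unfold dHy
  ring

/-- Exact expansion of the quadratic form `dHz` along a line (first-order term = the `z`-row of the Hessian of `H_a`). -/
theorem dHz_line (a : Fin 7 → ℝ) (p v : E3) (t : ℝ) :
    dHz a ((p + t • v) 0) ((p + t • v) 1) ((p + t • v) 2)
      = dHz a (p 0) (p 1) (p 2)
        + t * (v 0 * (-(6 * p 0 * a 0) + 2 * p 0 * a 3 + p 1 * a 4 + 8 * p 2 * a 1)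
          + v 1 * (p 0 * a 4 - 6 * p 1 * a 0 - 2 * p 1 * a 3 + 8 * p 2 * a 2)
          + v 2 * (8 * p 0 * a 1 + 8 * p 1 * a 2 + 12 * p 2 * a 0))
        + t ^ 2 * dHz a (v 0) (v 1) (v 2) := by
  simp only [PiLp.add_apply, PiLp.smul_apply, smul_eq_mul]
  unfold dHz
  ring

/-- `(d/dt)|₀ (K₀ + tK₁ + t²K₂ + t³K₃ + t⁴K₄) = K₁`. [folklore] -/
theorem hasDerivAt_quartic (K₀ K₁ K₂ K₃ K₄ : ℝ) :
    HasDerivAt (fun t : ℝ => K₀ + t * K₁ + t ^ 2 * K₂ + t ^ 3 * K₃ + t ^ 4 * K₄) K₁ 0 := by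
  have h1 : HasDerivAt (fun t : ℝ => t * K₁) K₁ 0 := by
    simpa using (hasDerivAt_id (0 : ℝ)).mul_const K₁
  have h2 : HasDerivAt (fun t : ℝ => t ^ 2 * K₂) 0 0 := by
    simpa using (hasDerivAt_pow 2 (0 : ℝ)).mul_const K₂
  have h3 : HasDerivAt (fun t : ℝ => t ^ 3 * K₃) 0 0 := by
    simpa using (hasDerivAt_pow 3 (0 : ℝ)).mul_const K₃
  have h4 : HasDerivAt (fun t : ℝ => t ^ 4 * K₄) 0 0 := by
    simpa using (hasDerivAt_pow 4 (0 : ℝ)).mul_const K₄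
  have h := ((((hasDerivAt_const (0 : ℝ) K₀).add h1).add h2).add h3).add h4
  simp only [zero_add, add_zero] at h
  exact h

/-- **`⟪∇G_a(p), v⟫ = 2 Σᵢ ∂ᵢH_a(p) · (Hess H_a(p) v)ᵢ`** with the written-out Hessian rows, `G_a = ‖∇H_a‖²`. -/
theorem inner_gradient_gradNormSq_cubicHE3 (a : Fin 7 → ℝ) (p v : E3) :
    ⟪gradient (fun w : E3 => ‖gradient (cubicHE3 a) w‖ ^ 2) p, v⟫
      = 2 * (dHx a (p 0) (p 1) (p 2)
            * (v 0 * (-(6 * p 0 * a 1) + 6 * p 0 * a 5 - 2 * p 1 * a 2 + 6 * p 1 * a 6 - 6 * p 2 * a 0 + 2 * p 2 * a 3)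
              + v 1 * (-(2 * p 0 * a 2) + 6 * p 0 * a 6 - 2 * p 1 * a 1 - 6 * p 1 * a 5 + p 2 * a 4)
              + v 2 * (-(6 * p 0 * a 0) + 2 * p 0 * a 3 + p 1 * a 4 + 8 * p 2 * a 1))
          + dHy a (p 0) (p 1) (p 2)
            * (v 0 * (-(2 * p 0 * a 2) + 6 * p 0 * a 6 - 2 * p 1 * a 1 - 6 * p 1 * a 5 + p 2 * a 4)
              + v 1 * (-(2 * p 0 * a 1) - 6 * p 0 * a 5 - 6 * p 1 * a 2 - 6 * p 1 * a 6 - 6 * p 2 * a 0 - 2 * p 2 * a 3)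
              + v 2 * (p 0 * a 4 - 6 * p 1 * a 0 - 2 * p 1 * a 3 + 8 * p 2 * a 2))
          + dHz a (p 0) (p 1) (p 2)
            * (v 0 * (-(6 * p 0 * a 0) + 2 * p 0 * a 3 + p 1 * a 4 + 8 * p 2 * a 1)
              + v 1 * (p 0 * a 4 - 6 * p 1 * a 0 - 2 * p 1 * a 3 + 8 * p 2 * a 2)
              + v 2 * (8 * p 0 * a 1 + 8 * p 1 * a 2 + 12 * p 2 * a 0))) := by
  rw [gradNormSq_cubicHE3_eq, inner_gradient_eq_fderiv]
  set Gp : E3 → ℝ := fun w : E3 => dHx a (w 0) (w 1) (w 2) ^ 2 + dHy a (w 0) (w 1) (w 2) ^ 2 + dHz a (w 0) (w 1) (w 2) ^ 2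
    with hGp
  -- abbreviations for the line data
  set A₁ := dHx a (p 0) (p 1) (p 2) with hA₁
  set A₂ := dHy a (p 0) (p 1) (p 2) with hA₂
  set A₃ := dHz a (p 0) (p 1) (p 2) with hA₃
  set B₁ := v 0 * (-(6 * p 0 * a 1) + 6 * p 0 * a 5 - 2 * p 1 * a 2 + 6 * p 1 * a 6 - 6 * p 2 * a 0 + 2 * p 2 * a 3)
    + v 1 * (-(2 * p 0 * a 2) + 6 * p 0 * a 6 - 2 * p 1 * a 1 - 6 * p 1 * a 5 + p 2 * a 4)
    + v 2 * (-(6 * p 0 * a 0) + 2 * p 0 * a 3 + p 1 * a 4 + 8 * p 2 * a 1) with hB₁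
  set B₂ := v 0 * (-(2 * p 0 * a 2) + 6 * p 0 * a 6 - 2 * p 1 * a 1 - 6 * p 1 * a 5 + p 2 * a 4)
    + v 1 * (-(2 * p 0 * a 1) - 6 * p 0 * a 5 - 6 * p 1 * a 2 - 6 * p 1 * a 6 - 6 * p 2 * a 0 - 2 * p 2 * a 3)
    + v 2 * (p 0 * a 4 - 6 * p 1 * a 0 - 2 * p 1 * a 3 + 8 * p 2 * a 2) with hB₂
  set B₃ := v 0 * (-(6 * p 0 * a 0) + 2 * p 0 * a 3 + p 1 * a 4 + 8 * p 2 * a 1)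
    + v 1 * (p 0 * a 4 - 6 * p 1 * a 0 - 2 * p 1 * a 3 + 8 * p 2 * a 2)
    + v 2 * (8 * p 0 * a 1 + 8 * p 1 * a 2 + 12 * p 2 * a 0) with hB₃
  set C₁ := dHx a (v 0) (v 1) (v 2) with hC₁
  set C₂ := dHy a (v 0) (v 1) (v 2) with hC₂
  set C₃ := dHz a (v 0) (v 1) (v 2) with hC₃
  -- the line restriction of `Gp` is an explicit quartic in `t`
  have hline : (fun t : ℝ => Gp (p + t • v)) = fun t : ℝ =>
      (A₁ ^ 2 + A₂ ^ 2 + A₃ ^ 2) + t * (2 * (A₁ * B₁ + A₂ * B₂ + A₃ * B₃))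
        + t ^ 2 * (B₁ ^ 2 + B₂ ^ 2 + B₃ ^ 2 + 2 * (A₁ * C₁ + A₂ * C₂ + A₃ * C₃))
        + t ^ 3 * (2 * (B₁ * C₁ + B₂ * C₂ + B₃ * C₃)) + t ^ 4 * (C₁ ^ 2 + C₂ ^ 2 + C₃ ^ 2) := by
    funext t
    simp only [hGp]
    rw [dHx_line, dHy_line, dHz_line]
    ring
  have hderiv : HasDerivAt (fun t : ℝ => Gp (p + t • v)) (2 * (A₁ * B₁ + A₂ * B₂ + A₃ * B₃)) 0 := by
    rw [hline]
    exact hasDerivAt_quartic _ _ _ _ _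
  -- `Gp` is differentiable, so the line derivative is `D Gp (p) v`
  have hdiff : Differentiable ℝ Gp := by
    have hc : ∀ i : Fin 3, Differentiable ℝ fun w : E3 => w i := fun i => differentiable_euclidean.mp differentiable_id i
    have h0 := hc 0
    have h1 := hc 1
    have h2 := hc 2
    simp only [hGp]
    unfold dHx dHy dHz
    fun_prop
  have hl : HasDerivAt (fun t : ℝ => p + t • v) v 0 := by
    simpa using ((hasDerivAt_id (0 : ℝ)).smul_const v).const_add p
  have hchain : HasDerivAt (Gp ∘ fun t : ℝ => p + t • v) (fderiv ℝ Gp p v) 0 := by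
    have h := (hdiff (p + (0 : ℝ) • v)).hasFDerivAt.comp_hasDerivAt (0 : ℝ) hl
    rw [zero_smul, add_zero] at h
    exact h
  exact hchain.unique hderiv

/-! ### The identification -/

-- a few-thousand-term identity after expansion: default recursion depth is too small for `ring`
set_option maxRecDepth 8192 in
/-- `horizonNumerator a p = −40 ⟪∇H_a(p), ∇G_a(p) × p⟫`: eng-7 g3's `horizonNumerator_eq_det` (p670909) read through the kernel
gradients of `H_a` and `G_a = ‖∇H_a‖²`. -/
theorem horizonNumerator_eq_inner_cross (a : Fin 7 → ℝ) (p : E3) :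
    horizonNumerator a (p 0) (p 1) (p 2)
      = -40 * ⟪gradient (cubicHE3 a) p, cross (gradient (fun w : E3 => ‖gradient (cubicHE3 a) w‖ ^ 2) p) p⟫ := by
  set g : E3 := gradient (fun w : E3 => ‖gradient (cubicHE3 a) w‖ ^ 2) p with hg
  have hg0 : g 0 = ⟪g, EuclideanSpace.single 0 (1 : ℝ)⟫ := by rw [EuclideanSpace.inner_single_right]; simp
  have hg1 : g 1 = ⟪g, EuclideanSpace.single 1 (1 : ℝ)⟫ := by rw [EuclideanSpace.inner_single_right]; simp
  have hg2 : g 2 = ⟪g, EuclideanSpace.single 2 (1 : ℝ)⟫ := by rw [EuclideanSpace.inner_single_right]; simp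
  rw [hg, inner_gradient_gradNormSq_cubicHE3] at hg0 hg1 hg2
  simp at hg0 hg1 hg2
  obtain ⟨c0, c1, c2⟩ := cross_fin3 g p
  rw [inner_gradient_cubicHE3, c0, c1, c2, hg0, hg1, hg2, horizonNumerator_eq_det]
  unfold dHx dHy dHz
  ring

/-- ★ **THE IDENTIFICATION STEP (ii) at l = 3.**  For every coefficient vector `a` and every `x ≠ 0`,
`‖x‖⁶ · horizonL2 (horizonProfile 3 (cubicHE3 a) 0) 0 x = horizonNumerator a (x 0) (x 1) (x 2)`:
the 450-term numerator of record (DATUM B-ht1, formerly ENGINE-certified only) IS `‖x‖⁶ 𝔏₂[U_{H_a}](x)` for the tree's `horizonL2` /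
`horizonProfile`.  From the all-degree law `horizonL2_horizonProfile_eq_det` at `l = 3` (`κ = 10`, `‖x‖^{3(l−1)} = ‖x‖⁶`). -/
theorem horizonL2_horizonProfile_cubicHE3 (a : Fin 7 → ℝ) {x : E3} (hx : x ≠ 0) :
    ‖x‖ ^ 6 * horizonL2 (horizonProfile 3 (cubicHE3 a) 0) 0 x = horizonNumerator a (x 0) (x 1) (x 2) := by
  rw [horizonL2_horizonProfile_eq_det (l := 3) (by norm_num) (contDiff_cubicHE3 a) (cubicHE3_smul a) (laplacian_cubicHE3 a) hx,
    horizonNumerator_eq_inner_cross]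
  have hr : ‖x‖ ≠ 0 := norm_ne_zero_iff.2 hx
  have h6 : ‖x‖ ^ (3 * (3 - 1)) = ‖x‖ ^ 6 := by norm_num
  rw [h6]
  field_simp
  push_cast
  ring

/-- The hypothesis `hident` of `horizonZonality_degree_three_of_identification` (p670358), discharged: where `𝔏₂[U_{H_a}]` vanishes
off the origin, the recorded numerator vanishes. -/
theorem horizonNumerator_eq_zero_of_horizonL2 (a : Fin 7 → ℝ) (x : E3) (hx : x ≠ 0)
    (h0 : horizonL2 (horizonProfile 3 (cubicHE3 a) 0) 0 x = 0) : horizonNumerator a (x 0) (x 1) (x 2) = 0 := by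
  rw [← horizonL2_horizonProfile_cubicHE3 a hx, h0, mul_zero]

end CubicCert

/-- ★ **`HorizonZonalitySingleDegree` at `l = 3`, UNCONDITIONAL.**  Every smooth, degree-3 homogeneous, harmonic `H : ℝ³ → ℝ` whose
horizon profile `U_H = horizonProfile 3 H 0` is annihilated by the order-two horizon law off the origin
(`∀ x ≠ 0, horizonL2 U_H 0 x = 0`) has the zonal functional form `H(y) = ‖y‖³ g(⟪n, y⟫/‖y‖)` about some axis `n ≠ 0` — literally
the body of `HorizonTower.HorizonZonalitySingleDegree` with `l := 3`.  Assembly: eng-7 g3's `horizonZonality_degree_three_of_identification`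
(bridges `exists_cubicHE3_of_harmonic_homogeneous`, certificate core `CubicCert.zonalForm_of_horizonNumerator_eq_zero`) with the
identification `CubicCert.horizonNumerator_eq_zero_of_horizonL2` of this file.  Information-grade for W1/W2 (movement 0);
`PoloidalLiouville` (1222) and NS regularity untouched. -/
theorem horizonZonality_degree_three (H : E3 → ℝ) (hH : ContDiff ℝ (⊤ : ℕ∞) H)
    (hhom : ∀ (c : ℝ) (y : E3), H (c • y) = c ^ 3 * H y) (hΔ : ∀ y : E3, Laplacian.laplacian H y = 0)
    (hL2 : ∀ x : E3, x ≠ 0 → horizonL2 (horizonProfile 3 H 0) 0 x = 0) :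
    ∃ (a : E3) (g : ℝ → ℝ), a ≠ 0 ∧ ∀ y : E3, y ≠ 0 → H y = ‖y‖ ^ 3 * g (inner ℝ a y / ‖y‖) :=
  horizonZonality_degree_three_of_identification CubicCert.horizonNumerator_eq_zero_of_horizonL2 H hH hhom hΔ hL2

/-- The `l = 3` cell of `HorizonZonalitySingleDegree` in the binder order of that Prop (`2 ≤ 3` discharged): for the record. -/
theorem horizonZonalitySingleDegree_three :
    ∀ (H : E3 → ℝ), 2 ≤ 3 → ContDiff ℝ (⊤ : ℕ∞) H → (∀ (c : ℝ) (y : E3), H (c • y) = c ^ 3 * H y) →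
      (∀ y, Laplacian.laplacian H y = 0) →
      (∀ x : E3, x ≠ 0 → horizonL2 (horizonProfile 3 H 0) 0 x = 0) →
      ∃ (a : E3) (g : ℝ → ℝ), a ≠ 0 ∧ ∀ y : E3, y ≠ 0 → H y = ‖y‖ ^ 3 * g (inner ℝ a y / ‖y‖) :=
  fun H _ hH hhom hΔ hL2 => horizonZonality_degree_three H hH hhom hΔ hL2

end Summit.NavierStokesRegularity.NavierStokesRegularity.Theorems.PoloidalLiouville.HorizonTower

end
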